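import Summits.AtomisticToContinuum.Crystallization.Theses.ReggeStarCoercivity
import Summits.AtomisticToContinuum.Crystallization.Theses.PalmUnimodularRigidity
import Summits.AtomisticToContinuum.Crystallization.Theorems.DefectFreeCrystallizes.Negative.PredicateAPI
import Summits.AtomisticToContinuum.Crystallization.Theorems.PalmUnimodularRigidityChargedPatternCrystallizes
import Summits.AtomisticToContinuum.Crystallization.Theorems.PalmUnimodularRigidityShellsToBarlowChart
import Summits.AtomisticToContinuum.Crystallization.Theorems.ReggeStarCoercivityDefectFreeCrystallizesPalmDefs
import Summits.AtomisticToContinuum.Crystallization.Theorems.ReggeStarCoercivityDefectFreeCrystallizesGoodLaw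
import Summits.AtomisticToContinuum.Crystallization.Theorems.ReggeStarCoercivityDefectFreeCrystallizesChargeFromLaw
import Summits.AtomisticToContinuum.Crystallization.Theorems.ReggeStarCoercivityDefectFreeCrystallizesFunnelReduction
import Summits.AtomisticToContinuum.Crystallization.Theorems.ReggeStarCoercivityDefectFreeCrystallizesFunnelCovering
import Summits.AtomisticToContinuum.Crystallization.Theorems.ReggeStarCoercivityDefectFreeCrystallizesFunnelBoundaryCount
import Summits.AtomisticToContinuum.Crystallization.Theorems.ReggeStarCoercivityDefectFreeCrystallizesFunnelFiniteGap
import Summits.AtomisticToContinuum.Crystallization.Theorems.ReggeStarCoercivityDefectFreeCrystallizesFunnelPricing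
import Summits.AtomisticToContinuum.Crystallization.Theorems.MinimiserShells.Negative.LoadBearing
import Summits.AtomisticToContinuum.Crystallization.Theorems.ChargedEnergyGap.Negative.BlocksBound
import Literature.MathematicalPhysics.StatisticalMechanics.LennardJonesClusters

/-!
# The CORE residual of line `palm-good-law` (crux stmt-AtomisticToContinuum-13603): the funnel periodic shell gap —
# what it gives (P3a, and the crux modulo crux 9226) and two sufficient forms (9225's S7‴; an e*-FREE reference floor)

Lead c2 reshaped P3a `FunnelToShells` of the line into the chain
CORE funnel periodic shell gap →(F13) funnel finite gap →(F11, with D covering and B boundary count) funnel threshold pricing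
→(`funnelToShells_of_funnelThresholdPricing`) `FunnelToShells`, all transfers LANDED (p121391, p121669, p120936, p121307, p119323).
This file records, sorry-free:

* `funnelToShells_of_funnelPeriodicShellGap` — P3a from the CORE alone (the chain composed);
* `defectFreeCrystallizes_of_funnelPeriodicShellGap` — **the crux modulo {CORE, crux 9226 `LayeredLawsSelectHcp`}** (crux 9227 is
  landed: `DevelopTheModelGrowthDescent.ShellsToBarlowChart_of`; P1, P5 landed);
* `funnelPeriodicShellGap_of_periodicShellGap` — the CORE is a trivial weakening of crux 9225's residual S7‴ `stub_periodicShellGap`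
  (same statement without the funnel budget `s`), so 13603 asks NOTHING of the energy that 9225 does not;
* `funnelPeriodicShellGap_of_referenceFloor` — the CORE follows from the **e*-FREE reference floor**: SOME periodic configuration
  `Q₀` lies at least `κ(t)` below every periodic configuration with at most `s(t)·#motif` non-`SetGood` and at least `t·#motif`
  badly-shelled motif sites (intended `Q₀` = relaxed hcp; uses only `e* ≤ e(Q₀)`, the landed `ChargedEnergyGapNegative.eStar_le`).  Unlike S7‴ — which needs the value
  of `e*` from below, i.e. the full 3-D Lennard-Jones crystal problem — the reference floor is a statement about explicit lattice
  sums on the close-packed funnel: the elastic / scale / shape exactification of 1/20-close-packed configurations against ONE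
  reference, the same kind of statement as crux 9226's two e*-free cores (`stub_hcpTubeRigidity`, `stub_selectionFloor`).
-/

noncomputable section

open MeasureTheory
open scoped ENNReal BigOperators

namespace Summit.AtomisticToContinuum.Crystallization.Theorems.PalmGoodLaw.FunnelCore

open Summit.AtomisticToContinuum.Crystallization.Theses
open Summit.AtomisticToContinuum.Crystallization.Theorems.DefectFreeCrystallizes.Negative.PredicateAPI
  (defectFreeCrystallizes_iff)
open Summit.AtomisticToContinuum.Crystallization.Theorems.MinimiserShells.Negative.LoadBearing (eStar GoodShell)
open Summit.AtomisticToContinuum.Crystallization.Theorems.ChargedEnergyGapNegative (eStar_le)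
open Literature.MathematicalPhysics.StatisticalMechanics (lennardJones interactionEnergy PeriodicConfiguration
  LennardJonesMinimalDistance_holds)

/-- **P3a from the CORE.**  The funnel periodic shell gap implies `FunnelToShells` (minimising point-stationary hard-core laws
a.s. carried by everywhere-`SetGood` configurations have a.s. a `1 %`-close-packed root shell): the landed chain F13 → F11 (with
D, B) → `funnelToShells_of_funnelThresholdPricing`. -/
theorem funnelToShells_of_funnelPeriodicShellGap :
    (∀ t : ℝ, 0 < t → ∃ κ : ℝ, 0 < κ ∧ ∃ s : ℝ, 0 < s ∧
      ∀ Q : PeriodicConfiguration 3,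
        (Nat.card {x : Q.motif // ¬ SetGood Q.points (x : EuclideanSpace ℝ (Fin 3))} : ℝ) ≤
            s * (Q.motif.card : ℝ) →
        t * (Q.motif.card : ℝ) ≤ (Nat.card {x : Q.motif // ¬ GoodShell
            ((Measure.count : Measure (EuclideanSpace ℝ (Fin 3))).restrict
              ((fun z => z - (x : EuclideanSpace ℝ (Fin 3))) '' Q.points))} : ℝ) →
        eStar + κ ≤ Q.energyPerParticle lennardJones) →
    FunnelToShells :=
  fun hcore => funnelToShells_of_funnelThresholdPricing
    (FunnelPricing.stub_funnelPricing_of_funnelFiniteGap FunnelCovering.stub_funnelCovering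
      FunnelBoundaryCount.stub_funnelBoundaryCount
      (FunnelFiniteGap.stub_funnelFiniteGap_of_funnelPeriodicShellGap hcore))

/-- **The crux modulo {CORE, crux 9226}.**  The funnel periodic shell gap and `LayeredLawsSelectHcp` (crux
stmt-AtomisticToContinuum-9226, by name) imply `DefectFreeCrystallizes` — through the LANDED P1 `stub_goodLaw`, P5 `stub_chargeFromLaw`,
crux 9227 `ShellsToBarlowChart_of`, `chargedPatternCrystallizes_proof` (2916) and `LennardJonesMinimalDistance_holds`. -/
theorem defectFreeCrystallizes_of_funnelPeriodicShellGap
    (hcore : ∀ t : ℝ, 0 < t → ∃ κ : ℝ, 0 < κ ∧ ∃ s : ℝ, 0 < s ∧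
      ∀ Q : PeriodicConfiguration 3,
        (Nat.card {x : Q.motif // ¬ SetGood Q.points (x : EuclideanSpace ℝ (Fin 3))} : ℝ) ≤
            s * (Q.motif.card : ℝ) →
        t * (Q.motif.card : ℝ) ≤ (Nat.card {x : Q.motif // ¬ GoodShell
            ((Measure.count : Measure (EuclideanSpace ℝ (Fin 3))).restrict
              ((fun z => z - (x : EuclideanSpace ℝ (Fin 3))) '' Q.points))} : ℝ) →
        eStar + κ ≤ Q.energyPerParticle lennardJones)
    (hSelect : PalmUnimodularRigidity.LayeredLawsSelectHcp) :
    Summit.AtomisticToContinuum.Crystallization.Theses.ReggeStarCoercivity.DefectFreeCrystallizes := by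
  rw [defectFreeCrystallizes_iff]
  intro hZ
  exact Summit.AtomisticToContinuum.Crystallization.Theorems.chargedPatternCrystallizes_proof
    (stub_chargeFromLaw stub_goodLaw (funnelToShells_of_funnelPeriodicShellGap hcore)
      Summit.AtomisticToContinuum.Crystallization.Cruxes.ShellsToBarlowChart.DevelopTheModelGrowthDescent.ShellsToBarlowChart_of
      hSelect hZ)
    LennardJonesMinimalDistance_holds

/-- **The CORE is a weakening of crux 9225's residual S7‴** (`stub_periodicShellGap`: the periodic shell gap WITHOUT the funnel
budget): forget the non-`SetGood` hypothesis (any `s`, e.g. `s = 1`). -/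
theorem funnelPeriodicShellGap_of_periodicShellGap
    (hS7 : ∀ t : ℝ, 0 < t → ∃ κ : ℝ, 0 < κ ∧
      ∀ Q : PeriodicConfiguration 3,
        t * (Q.motif.card : ℝ) ≤ (Nat.card {x : Q.motif // ¬ GoodShell
            ((Measure.count : Measure (EuclideanSpace ℝ (Fin 3))).restrict
              ((fun z => z - (x : EuclideanSpace ℝ (Fin 3))) '' Q.points))} : ℝ) →
        eStar + κ ≤ Q.energyPerParticle lennardJones) :
    ∀ t : ℝ, 0 < t → ∃ κ : ℝ, 0 < κ ∧ ∃ s : ℝ, 0 < s ∧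
      ∀ Q : PeriodicConfiguration 3,
        (Nat.card {x : Q.motif // ¬ SetGood Q.points (x : EuclideanSpace ℝ (Fin 3))} : ℝ) ≤
            s * (Q.motif.card : ℝ) →
        t * (Q.motif.card : ℝ) ≤ (Nat.card {x : Q.motif // ¬ GoodShell
            ((Measure.count : Measure (EuclideanSpace ℝ (Fin 3))).restrict
              ((fun z => z - (x : EuclideanSpace ℝ (Fin 3))) '' Q.points))} : ℝ) →
        eStar + κ ≤ Q.energyPerParticle lennardJones := by
  intro t ht
  obtain ⟨κ, hκ, h⟩ := hS7 t ht
  exact ⟨κ, hκ, 1, one_pos, fun Q _ hbad => h Q hbad⟩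

/-- **The CORE from the e*-FREE reference floor.**  If SOME periodic configuration `Q₀` lies at least `κ(t) > 0` below every
periodic configuration with at most `s(t)·#motif` non-`SetGood` and at least `t·#motif` badly-shelled motif sites, the funnel
periodic shell gap holds (because `e* ≤ e(Q₀)`).  The reference floor names no infimum: with `Q₀` = relaxed hcp it is a statement
about explicit Lennard-Jones lattice sums on the close-packed funnel. -/
theorem funnelPeriodicShellGap_of_referenceFloor
    (href : ∃ Q₀ : PeriodicConfiguration 3, ∀ t : ℝ, 0 < t → ∃ κ : ℝ, 0 < κ ∧ ∃ s : ℝ, 0 < s ∧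
      ∀ Q : PeriodicConfiguration 3,
        (Nat.card {x : Q.motif // ¬ SetGood Q.points (x : EuclideanSpace ℝ (Fin 3))} : ℝ) ≤
            s * (Q.motif.card : ℝ) →
        t * (Q.motif.card : ℝ) ≤ (Nat.card {x : Q.motif // ¬ GoodShell
            ((Measure.count : Measure (EuclideanSpace ℝ (Fin 3))).restrict
              ((fun z => z - (x : EuclideanSpace ℝ (Fin 3))) '' Q.points))} : ℝ) →
        Q₀.energyPerParticle lennardJones + κ ≤ Q.energyPerParticle lennardJones) :
    ∀ t : ℝ, 0 < t → ∃ κ : ℝ, 0 < κ ∧ ∃ s : ℝ, 0 < s ∧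
      ∀ Q : PeriodicConfiguration 3,
        (Nat.card {x : Q.motif // ¬ SetGood Q.points (x : EuclideanSpace ℝ (Fin 3))} : ℝ) ≤
            s * (Q.motif.card : ℝ) →
        t * (Q.motif.card : ℝ) ≤ (Nat.card {x : Q.motif // ¬ GoodShell
            ((Measure.count : Measure (EuclideanSpace ℝ (Fin 3))).restrict
              ((fun z => z - (x : EuclideanSpace ℝ (Fin 3))) '' Q.points))} : ℝ) →
        eStar + κ ≤ Q.energyPerParticle lennardJones := by
  obtain ⟨Q₀, h⟩ := href
  intro t ht
  obtain ⟨κ, hκ, s, hs, hQ⟩ := h t ht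
  refine ⟨κ, hκ, s, hs, fun Q hfun hbad => ?_⟩
  have h₀ : eStar ≤ Q₀.energyPerParticle lennardJones := eStar_le Q₀
  have h₁ := hQ Q hfun hbad
  linarith

/-- Hence **the crux modulo {e*-free reference floor, crux 9226}** — no `⨅` over periodic configurations is left in the energy
hypothesis of crux stmt-AtomisticToContinuum-13603's line `palm-good-law`. -/
theorem defectFreeCrystallizes_of_referenceFloor
    (href : ∃ Q₀ : PeriodicConfiguration 3, ∀ t : ℝ, 0 < t → ∃ κ : ℝ, 0 < κ ∧ ∃ s : ℝ, 0 < s ∧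
      ∀ Q : PeriodicConfiguration 3,
        (Nat.card {x : Q.motif // ¬ SetGood Q.points (x : EuclideanSpace ℝ (Fin 3))} : ℝ) ≤
            s * (Q.motif.card : ℝ) →
        t * (Q.motif.card : ℝ) ≤ (Nat.card {x : Q.motif // ¬ GoodShell
            ((Measure.count : Measure (EuclideanSpace ℝ (Fin 3))).restrict
              ((fun z => z - (x : EuclideanSpace ℝ (Fin 3))) '' Q.points))} : ℝ) →
        Q₀.energyPerParticle lennardJones + κ ≤ Q.energyPerParticle lennardJones)
    (hSelect : PalmUnimodularRigidity.LayeredLawsSelectHcp) :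
    Summit.AtomisticToContinuum.Crystallization.Theses.ReggeStarCoercivity.DefectFreeCrystallizes :=
  defectFreeCrystallizes_of_funnelPeriodicShellGap (funnelPeriodicShellGap_of_referenceFloor href) hSelect

end Summit.AtomisticToContinuum.Crystallization.Theorems.PalmGoodLaw.FunnelCore

end
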